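import Summits.Ventures.HodgeRepro.Night1ProductWeilRational

/-!
# Künneth for the Weil lines on the kernel: the `σ`-line of a product `B₁ × B₂` is the product of the
`σ`-lines of the factors, and the Weil space of the product is spanned by these diagonal products

Blind re-derivation cell `pub-hodge-repro`, seat `night-1` (gen 5).  Imports night-1's
`Night1ProductWeilRational` (through it `Night1ProductWeilSpace`: the `σ`-lines `weilWedgeProd e σ`, the Weil
space `weilSpaceProd`, the rational Weil classes `ratWeil`).

ROUTE.md §3.6 reduces S4 to INDECOMPOSABLE zero-sum multisets of CM types through «`W_F(B) = W_F(B′) ⊗ W_F(B″)`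
for `B = B′ × B″` (the Künneth component of the product of the two `F`-lines is the `F`-line of `B` — S2's
character bookkeeping)», and the abstract Weil model of the cell (night-3's `WeilModel`, Lemma P step (1))
takes the eigenline identification `κ (ℓ (a+b) σ) = ℓ a σ ⊗ ℓ b σ` as a hypothesis.  On the `G`-set model
this is a theorem about coordinate wedges: split the corners `ι = ι₁ ⊕ ι₂`, read `ℂ^{ι × G}` as the direct
sum of `ℂ^{ι₁ × G}` and `ℂ^{ι₂ × G}` (extension by zero `inlMap` / `inrMap`), and

* **`coe_weilWedgeProd_sumEnum`** — in the exterior algebra, the `σ`-line of the product equals the product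
  of the images of the `σ`-lines of the two factors (`sumEnum e₁ e₂` enumerates `ι₁ ⊕ ι₂` by the two
  enumerations; `ExteriorAlgebra.ιMulti_mul_ιMulti` after the reindexing `2(k₁ + k₂) = 2k₁ + 2k₂`);
* **`map_weilSpaceProd_sumEnum`** — the Weil space of the product is the span of the DIAGONAL products
  `ℓ₁σ · ℓ₂σ` (not of all products `ℓ₁σ · ℓ₂τ`: `W_F(B)` is `W_F(B₁) ⊗_F W_F(B₂)`, of dimension `|G|`, inside
  `W_F(B₁) ⊗_ℚ W_F(B₂)`, of dimension `|G|²` — which is exactly what Lemma P's projection has to undo);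
* `coe_ratWeil_sumEnum` — the rational Weil class of `f ∈ K` on the product is `Σ_g φ₀(g f) ℓ₁g · ℓ₂g`.

Nothing geometric is built; every statement is about coordinate wedges on the finite `G`-sets `ι × G`.
Nothing here says anything about the status of the Hodge conjecture for CM abelian varieties, which is
NOT proved.
-/

set_option autoImplicit false

open Finset Module
open scoped Pointwise

namespace HodgeRepro.RouteC

open CMHodgeOn

section Kunneth

variable {G : Type*} [Group G] [DecidableEq G] [Fintype G]
variable {ι₁ ι₂ : Type*} [Fintype ι₁] [DecidableEq ι₁] [Fintype ι₂] [DecidableEq ι₂]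

omit [Group G] [DecidableEq G] [Fintype G] [Fintype ι₁] [DecidableEq ι₁] [Fintype ι₂] [DecidableEq ι₂] in
/-- The enumeration of the corners `ι₁ ⊕ ι₂` of a product by enumerations of the two factors: the first
`2k₁` indices enumerate `ι₁`, the last `2k₂` enumerate `ι₂`. -/
def sumEnum {k₁ k₂ : ℕ} (e₁ : Fin (2 * k₁) ≃ ι₁) (e₂ : Fin (2 * k₂) ≃ ι₂) :
    Fin (2 * (k₁ + k₂)) ≃ ι₁ ⊕ ι₂ :=
  (finCongr (by ring)).trans (finSumFinEquiv.symm.trans (e₁.sumCongr e₂))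

omit [Group G] [DecidableEq G] [Fintype G] [Fintype ι₁] [DecidableEq ι₁] [Fintype ι₂] [DecidableEq ι₂] in
/-- The extension by zero `ℂ^{ι₁ × G} → ℂ^{(ι₁ ⊕ ι₂) × G}`. -/
noncomputable def inlMap : ((ι₁ × G) → ℂ) →ₗ[ℂ] (((ι₁ ⊕ ι₂) × G) → ℂ) :=
  Function.ExtendByZero.linearMap ℂ fun q : ι₁ × G => ((Sum.inl q.1 : ι₁ ⊕ ι₂), q.2)

omit [Group G] [DecidableEq G] [Fintype G] [Fintype ι₁] [DecidableEq ι₁] [Fintype ι₂] [DecidableEq ι₂] in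
/-- The extension by zero `ℂ^{ι₂ × G} → ℂ^{(ι₁ ⊕ ι₂) × G}`. -/
noncomputable def inrMap : ((ι₂ × G) → ℂ) →ₗ[ℂ] (((ι₁ ⊕ ι₂) × G) → ℂ) :=
  Function.ExtendByZero.linearMap ℂ fun q : ι₂ × G => ((Sum.inr q.1 : ι₁ ⊕ ι₂), q.2)

omit [Group G] [Fintype G] [Fintype ι₁] [Fintype ι₂] in
/-- `inlMap` carries the coordinate vector of `(i, τ)` to that of `(inl i, τ)`. -/
theorem inlMap_coordVecOn (q : ι₁ × G) :
    inlMap (ι₂ := ι₂) (coordVecOn q) = coordVecOn ((Sum.inl q.1 : ι₁ ⊕ ι₂), q.2) := by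
  have hinj : Function.Injective fun q : ι₁ × G => ((Sum.inl q.1 : ι₁ ⊕ ι₂), q.2) := by
    intro a b h
    simp only [Prod.mk.injEq, Sum.inl.injEq] at h
    exact Prod.ext h.1 h.2
  funext x
  rcases x with ⟨i | j, τ⟩
  · have := hinj.extend_apply (coordVecOn q) (0 : ((ι₁ ⊕ ι₂) × G) → ℂ) (i, τ)
    simp only [inlMap, Function.ExtendByZero.linearMap_apply]
    rw [this, coordVecOn_apply, coordVecOn_apply]
    simp [Prod.ext_iff]
  · simp only [inlMap, Function.ExtendByZero.linearMap_apply]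
    rw [Function.extend_apply' _ _ _ (by rintro ⟨a, ha⟩; simp at ha), Pi.zero_apply, coordVecOn_apply,
      if_neg (by simp)]

omit [Group G] [Fintype G] [Fintype ι₁] [Fintype ι₂] in
/-- `inrMap` carries the coordinate vector of `(j, τ)` to that of `(inr j, τ)`. -/
theorem inrMap_coordVecOn (q : ι₂ × G) :
    inrMap (ι₁ := ι₁) (coordVecOn q) = coordVecOn ((Sum.inr q.1 : ι₁ ⊕ ι₂), q.2) := by
  have hinj : Function.Injective fun q : ι₂ × G => ((Sum.inr q.1 : ι₁ ⊕ ι₂), q.2) := by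
    intro a b h
    simp only [Prod.mk.injEq, Sum.inr.injEq] at h
    exact Prod.ext h.1 h.2
  funext x
  rcases x with ⟨i | j, τ⟩
  · simp only [inrMap, Function.ExtendByZero.linearMap_apply]
    rw [Function.extend_apply' _ _ _ (by rintro ⟨a, ha⟩; simp at ha), Pi.zero_apply, coordVecOn_apply,
      if_neg (by simp)]
  · have := hinj.extend_apply (coordVecOn q) (0 : ((ι₁ ⊕ ι₂) × G) → ℂ) (j, τ)
    simp only [inrMap, Function.ExtendByZero.linearMap_apply]
    rw [this, coordVecOn_apply, coordVecOn_apply]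
    simp [Prod.ext_iff]

omit [Group G] [DecidableEq G] [Fintype G] [Fintype ι₁] [DecidableEq ι₁] [Fintype ι₂] [DecidableEq ι₂] in
/-- The reindexing `Fin (2(k₁ + k₂)) → Fin (2k₁ + 2k₂)`. -/
theorem sumEnum_apply_cast {k₁ k₂ : ℕ} (e₁ : Fin (2 * k₁) ≃ ι₁) (e₂ : Fin (2 * k₂) ≃ ι₂)
    (i : Fin (2 * k₁ + 2 * k₂)) :
    sumEnum e₁ e₂ (Fin.cast (by ring) i) = (e₁.sumCongr e₂) (finSumFinEquiv.symm i) := by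
  simp only [sumEnum, Equiv.trans_apply, finCongr_apply]
  congr 2

omit [Group G] [Fintype G] [Fintype ι₁] [Fintype ι₂] in
/-- **Künneth for the Weil lines**: in the exterior algebra, the `σ`-line of the product `B₁ × B₂`
(corners `ι₁ ⊕ ι₂`, enumerated by `sumEnum e₁ e₂`) is the product of the images of the `σ`-lines of the
factors. -/
theorem coe_weilWedgeProd_sumEnum {k₁ k₂ : ℕ} (e₁ : Fin (2 * k₁) ≃ ι₁) (e₂ : Fin (2 * k₂) ≃ ι₂) (σ : G) :
    (weilWedgeProd (sumEnum e₁ e₂) σ : ExteriorAlgebra ℂ (((ι₁ ⊕ ι₂) × G) → ℂ)) =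
      ExteriorAlgebra.map (inlMap (ι₂ := ι₂)) (weilWedgeProd e₁ σ) *
        ExteriorAlgebra.map (inrMap (ι₁ := ι₁)) (weilWedgeProd e₂ σ) := by
  simp only [weilWedgeProd, coordWedgeOn, exteriorPower.ιMulti_apply_coe,
    ExteriorAlgebra.map_apply_ιMulti, ExteriorAlgebra.ιMulti_mul_ιMulti]
  rw [ExteriorAlgebra.ιMulti_apply, ExteriorAlgebra.ιMulti_apply,
    List.ofFn_congr (show 2 * (k₁ + k₂) = 2 * k₁ + 2 * k₂ by ring)]
  refine congrArg List.prod (congrArg List.ofFn (funext fun i => congrArg (ExteriorAlgebra.ι ℂ) ?_))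
  refine Fin.addCases (fun a => ?_) (fun a => ?_) i
  · rw [Fin.append_left, Function.comp_apply, inlMap_coordVecOn]
    simp only [lineEnum, sumEnum_apply_cast, finSumFinEquiv_symm_apply_castAdd, Equiv.sumCongr_apply,
      Sum.map_inl]
  · rw [Fin.append_right, Function.comp_apply, inrMap_coordVecOn]
    simp only [lineEnum, sumEnum_apply_cast, finSumFinEquiv_symm_apply_natAdd, Equiv.sumCongr_apply,
      Sum.map_inr]

omit [Group G] [Fintype G] [Fintype ι₁] [Fintype ι₂] in
/-- **Künneth for the Weil space**: read in the exterior algebra, the Weil space of the product is the span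
of the DIAGONAL products `ℓ₁σ · ℓ₂σ`, `σ ∈ G` (dimension `|G|`, not `|G|²`). -/
theorem map_weilSpaceProd_sumEnum {k₁ k₂ : ℕ} (e₁ : Fin (2 * k₁) ≃ ι₁) (e₂ : Fin (2 * k₂) ≃ ι₂) :
    (weilSpaceProd G (k₁ + k₂) (sumEnum e₁ e₂)).map
        (⋀[ℂ]^(2 * (k₁ + k₂)) (((ι₁ ⊕ ι₂) × G) → ℂ)).subtype =
      Submodule.span ℂ (Set.range fun σ : G =>
        ExteriorAlgebra.map (inlMap (ι₂ := ι₂))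
            (weilWedgeProd e₁ σ : ExteriorAlgebra ℂ ((ι₁ × G) → ℂ)) *
          ExteriorAlgebra.map (inrMap (ι₁ := ι₁))
            (weilWedgeProd e₂ σ : ExteriorAlgebra ℂ ((ι₂ × G) → ℂ))) := by
  rw [weilSpaceProd, Submodule.map_span]
  congr 1
  ext x
  simp only [Set.mem_image, Set.mem_range, exists_exists_eq_and, Submodule.coe_subtype]
  constructor
  · rintro ⟨σ, rfl⟩
    exact ⟨σ, (coe_weilWedgeProd_sumEnum e₁ e₂ σ).symm⟩
  · rintro ⟨σ, rfl⟩
    exact ⟨σ, coe_weilWedgeProd_sumEnum e₁ e₂ σ⟩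

end Kunneth

/-! ### The rational Weil classes of a product -/

section Rational

open CMHodge
open scoped Classical

variable (K : Type*) [Field K] [NumberField K] [IsGalois ℚ K] (φ₀ : K →+* ℂ)
variable {ι₁ ι₂ : Type*} [Fintype ι₁] [DecidableEq ι₁] [Fintype ι₂] [DecidableEq ι₂]

omit [IsGalois ℚ K] [Fintype ι₁] [Fintype ι₂] in
/-- The rational Weil class of `f ∈ K` on the product `B₁ × B₂` is `Σ_g φ₀(g f) ℓ₁g · ℓ₂g` in the exterior
algebra: the diagonal combination of the products of the lines. -/
theorem coe_ratWeil_sumEnum {k₁ k₂ : ℕ} (e₁ : Fin (2 * k₁) ≃ ι₁) (e₂ : Fin (2 * k₂) ≃ ι₂) (f : K) :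
    (ratWeil K φ₀ (sumEnum e₁ e₂) f : ExteriorAlgebra ℂ (((ι₁ ⊕ ι₂) × (K ≃ₐ[ℚ] K)) → ℂ)) =
      ∑ g : K ≃ₐ[ℚ] K, φ₀ (g f) •
        (ExteriorAlgebra.map (inlMap (ι₂ := ι₂))
            (weilWedgeProd e₁ g : ExteriorAlgebra ℂ ((ι₁ × (K ≃ₐ[ℚ] K)) → ℂ)) *
          ExteriorAlgebra.map (inrMap (ι₁ := ι₁))
            (weilWedgeProd e₂ g : ExteriorAlgebra ℂ ((ι₂ × (K ≃ₐ[ℚ] K)) → ℂ))) := by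
  rw [ratWeil, Submodule.coe_sum]
  refine Finset.sum_congr rfl fun g _ => ?_
  rw [Submodule.coe_smul, coe_weilWedgeProd_sumEnum]

end Rational

end HodgeRepro.RouteC
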